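import Literature.Analysis.FluidPDE.LocalLeraySolutions
import Literature.Analysis.FluidPDE.SuitableWeakRescaling
import Literature.Analysis.FluidPDE.KatoLocalCovariance
import Literature.Analysis.FluidPDE.KatoMaximalTime
import HarnessLib

/-!
# Local Leray solutions under space–time rescaling (dilations, translations, viscosity change)

Analysis/FluidPDE support file, definitions-free. The local-Leray / `L³` theory of
Lemarié-Rieusset (*The Navier–Stokes Problem in the 21st Century* (2016), Ch. 14–15) is printed
for every viscosity `ν > 0`, whereas Rusin–Šverák 2011, Jia–Šverák 2013/2014, Seregin 2012 and
Kang–Miura–Tsai 2021 normalise `ν = 1`; accordingly some of the tree's named facts about the class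
`IsLocalLeraySolution` (`LocalLeraySolutions.lean`: Jia–Šverák's `𝒩(u₀)` = Kang–Miura–Tsai
Def. 3.2) carry `ν = 1` (`leray_solution_exists_of_memLp_three`, `leray_solution_ae_eq_kato`,
`rusin_sverak_stability_of_singularities`, …) and others a general `ν`
(`leray_solution_exists_ae_eq_kato`, `leray_solution_L3_weak_stability`, `seregin_blowup_profile`).
The two normalisations are related by the elementary symmetry
`u(t, x) ↦ α u(β t, x₀ + γ y)`, `β = α γ`, viscosity `ν ↦ α ν / γ` (Caffarelli–Kohn–Nirenberg 1982,
§2; for `β = 1`, `α = √ν`, `γ = 1/√ν` it maps viscosity `1` to viscosity `ν` without moving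
times). This file **proves** the covariance of the two classes involved:

* `IsLocalLeraySolution.stRescale` — if `(U, P)` is a local Leray solution with viscosity `ν` and
  datum `U₀` (suitable weak solution on `(0, ∞) × ℝ³`, uniformly local energy bounds for every
  radius, datum attained in `L²_loc`, decay at spatial infinity), then for `α, γ > 0`, `β = α γ`,
  `x₀ ∈ ℝ³`, the pair `α U(β ·, x₀ + γ ·)`, `α² P(β ·, x₀ + γ ·)` is a local Leray solution with
  viscosity `α ν / γ` and datum `α U₀(x₀ + γ ·)`: the suitable-weak-solution clause is the accepted
  `IsSuitableWeakSolutionOn.stRescale` (`SuitableWeakRescaling.lean`), and every remaining clause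
  of Kang–Miura–Tsai's Def. 3.2 is a change of variables (`SpaceTimeRescaling.lean`) in which a
  ball of radius `R` becomes a ball of radius `γ R` and the time window `(0, R²)` becomes
  `(0, β R²)`, both inside the window of radius `max (γ R) (√β R)`;
* `IsKatoSolutionOn.nsRescale` — the parabolic rescaling about the origin for Kato solutions on
  `[0, T)` (`KatoMaximalTime.lean`), from the accepted `kato_local_rescale_translate` (the
  viscosity scaling of Kato solutions, `IsKatoSolutionOn.timeRescale`, and the time-dilation
  covariance of local Leray solutions, `IsLocalLeraySolution.viscosityRescale`, are in
  `LerayFarFieldRegularity.lean` / `LocalLerayViscosityScaling.lean`; the present lemma adds space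
  dilations and translations, under which singular points can be moved to `(1, 0)`).

## Mathlib / tree search

Tree: `IsSuitableWeakSolutionOn.stRescale` (`SuitableWeakRescaling.lean`); `stAffine`, `stPull`,
`stPreimage`, `stAffine_preimage_cylinder`, `setLIntegral_enorm_pow_stRescale`,
`setLIntegral_enorm_rpow_stRescale`, `setLIntegral_frobeniusNormSq_stRescale`,
`setLIntegral_preimage_comp_space_affine`, `space_affine_preimage_ball`,
`ae_restrict_Ioo_comp_time_affine`, `spaceAffineHomeomorph`, `HasWeakSpatialGradientOn.stRescale`
(`SpaceTimeRescaling.lean`); `kato_local_rescale_translate` (`KatoLocalCovariance.lean`);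
`IsLocalLeraySolution.viscosityRescale`, `stPreimage_slab_Ioi` (time dilation only, `γ = 1`,
`x₀ = 0`; `LocalLerayViscosityScaling.lean`). Mathlib: `Homeomorph.map_cocompact`,
`lintegral_mono_set`, `ENNReal.Tendsto.const_mul`.

## References

* L. Caffarelli, R. Kohn, L. Nirenberg, CPAM 35 (1982), §2 (scaling of suitable weak solutions).
* P. G. Lemarié-Rieusset, *The Navier–Stokes Problem in the 21st Century* (2016), Def. 14.1,
  Ch. 15 (general viscosity `ν`).
* K. Kang, H. Miura, T.-P. Tsai, IMRN 2021 = arXiv:1812.10509, Def. 3.2 (unit viscosity).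
* W. Rusin, V. Šverák, J. Funct. Anal. 260 (2011) = arXiv:0911.0500, §1 p. 3 (unit viscosity).
-/

noncomputable section

open MeasureTheory TopologicalSpace Set Function Filter Topology Metric Module
open scoped ENNReal NNReal RealInnerProductSpace

namespace Literature.Analysis.FluidPDE

/-! ### Preimages under the affine maps with `t₀ = 0` -/

section Preimages

variable {E : Type*} [NormedAddCommGroup E] [InnerProductSpace ℝ E]

/-- The open half-space slab `(0, ∞) × E` is invariant under `Φ(s, y) = (β s, x₀ + γ y)`,
`β > 0`. [folklore] -/
theorem stPreimage_slab_Ioi_of_pos {β : ℝ} (hβ : 0 < β) (γ : ℝ) (x₀ : E) :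
    stPreimage β γ 0 x₀ (slab E (Ioi 0) isOpen_Ioi) = slab E (Ioi 0) isOpen_Ioi := by
  ext z
  simp only [coe_stPreimage, mem_preimage, SetLike.mem_coe, mem_slab, stAffine_fst, zero_add,
    mem_Ioi]
  exact mul_pos_iff_of_pos_left hβ

/-- `Φ⁻¹((0, βT) × Φ_x(K)) = (0, T) × K` for `Φ(s, y) = (β s, x₀ + γ y)`, `β > 0`, `γ ≠ 0`
(`Φ_x(y) = x₀ + γ y` is injective). [folklore] -/
theorem stAffine_preimage_Ioo_prod_image {β γ : ℝ} (hβ : 0 < β) (hγ : γ ≠ 0) (x₀ : E) (T : ℝ)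
    (K : Set E) :
    stAffine β γ 0 x₀ ⁻¹' (Ioo 0 (β * T) ×ˢ ((fun y : E => x₀ + γ • y) '' K)) = Ioo 0 T ×ˢ K := by
  have hinj : Injective (fun y : E => x₀ + γ • y) := (spaceAffineHomeomorph hγ x₀).injective
  ext ⟨s, y⟩
  simp only [mem_preimage, stAffine_apply, zero_add, mem_prod, mem_Ioo, hinj.mem_set_image]
  constructor
  · rintro ⟨⟨h1, h2⟩, h3⟩
    exact ⟨⟨(mul_pos_iff_of_pos_left hβ).1 h1, lt_of_mul_lt_mul_left h2 hβ.le⟩, h3⟩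
  · rintro ⟨⟨h1, h2⟩, h3⟩
    exact ⟨⟨mul_pos hβ h1, mul_lt_mul_of_pos_left h2 hβ⟩, h3⟩

/-- `Φ⁻¹((0, βS) × B(x₀ + γ y₁, γ R)) = (0, S) × B(y₁, R)` for `Φ(s, y) = (β s, x₀ + γ y)`,
`β, γ > 0`. [folklore] -/
theorem stAffine_preimage_Ioo_prod_ball {β γ : ℝ} (hβ : 0 < β) (hγ : 0 < γ) (x₀ : E) (S R : ℝ)
    (y₁ : E) :
    stAffine β γ 0 x₀ ⁻¹' (Ioo 0 (β * S) ×ˢ ball (x₀ + γ • y₁) (γ * R)) = Ioo 0 S ×ˢ ball y₁ R := by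
  rw [stAffine_preimage_cylinder hβ hγ]
  congr 2
  · simp
  · rw [sub_zero, mul_div_cancel_left₀ _ hβ.ne']
  · rw [add_sub_cancel_left, smul_smul, inv_mul_cancel₀ hγ.ne', one_smul]
  · rw [mul_div_cancel_left₀ _ hγ.ne']

/-- `Φ_x⁻¹(B(x₀ + γ y₁, γ R)) = B(y₁, R)` for `Φ_x(y) = x₀ + γ y`, `γ > 0`. [folklore] -/
theorem space_affine_preimage_ball_self {γ : ℝ} (hγ : 0 < γ) (x₀ y₁ : E) (R : ℝ) :
    (fun y : E => x₀ + γ • y) ⁻¹' ball (x₀ + γ • y₁) (γ * R) = ball y₁ R := by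
  rw [space_affine_preimage_ball hγ, add_sub_cancel_left, smul_smul, inv_mul_cancel₀ hγ.ne',
    one_smul, mul_div_cancel_left₀ _ hγ.ne']

variable [FiniteDimensional ℝ E] [MeasurableSpace E] [BorelSpace E]

/-- Space change of variables over a set and its image:
`∫⁻_K F(x₀ + γ y) dy = (γⁿ)⁻¹ ∫⁻_{Φ_x(K)} F` (`γ > 0`). [folklore] -/
theorem setLIntegral_comp_space_affine_image {γ : ℝ} (hγ : 0 < γ) (x₀ : E) (F : E → ℝ≥0∞)
    (K : Set E) :
    ∫⁻ y in K, F (x₀ + γ • y) =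
      ENNReal.ofReal (γ ^ finrank ℝ E)⁻¹ * ∫⁻ x in (fun y : E => x₀ + γ • y) '' K, F x := by
  have hinj : Injective (fun y : E => x₀ + γ • y) := (spaceAffineHomeomorph hγ.ne' x₀).injective
  conv_lhs => rw [← preimage_image_eq K hinj]
  exact setLIntegral_preimage_comp_space_affine hγ x₀ F _

omit [FiniteDimensional ℝ E] [MeasurableSpace E] [BorelSpace E] in
/-- The radius bookkeeping of the rescaling: with `R' = max (γ R) (√β R)`, `R ≥ 0`, one has
`γ R ≤ R'` and `β R² ≤ R'²` (`β ≥ 0`). [folklore] -/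
theorem rescale_radius_le {β γ R : ℝ} (hβ : 0 ≤ β) (hR : 0 ≤ R) :
    γ * R ≤ max (γ * R) (Real.sqrt β * R) ∧ β * R ^ 2 ≤ max (γ * R) (Real.sqrt β * R) ^ 2 := by
  refine ⟨le_max_left _ _, ?_⟩
  have h1 : β * R ^ 2 = (Real.sqrt β * R) ^ 2 := by
    rw [mul_pow, Real.sq_sqrt hβ]
  rw [h1]
  exact pow_le_pow_left₀ (mul_nonneg (Real.sqrt_nonneg β) hR) (le_max_right _ _) 2

omit [FiniteDimensional ℝ E] [MeasurableSpace E] [BorelSpace E] in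
/-- The rescaled radius `max (γ R) (√β R)` is positive for `γ, R > 0`. [folklore] -/
theorem rescale_radius_pos {β γ R : ℝ} (hγ : 0 < γ) (hR : 0 < R) :
    0 < max (γ * R) (Real.sqrt β * R) :=
  lt_max_of_lt_left (mul_pos hγ hR)

end Preimages

/-! ### Local Leray solutions under the rescaling -/

section LocalLeray

/-- **Covariance of local Leray solutions under space–time rescaling.** If `(U, P)` is a local
Leray solution of the unforced equations with viscosity `ν` and datum `U₀` (Kang–Miura–Tsai
Def. 3.2 on `(0, ∞) × ℝ³`), then for `α, γ > 0`, `β = α γ`, `x₀ ∈ ℝ³`, the rescaled pair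
`w(s, y) = α U(β s, x₀ + γ y)`, `q(s, y) = α² P(β s, x₀ + γ y)` is a local Leray solution with
viscosity `α ν / γ` and datum `w₀(y) = α U₀(x₀ + γ y)`: (1)+(4) by
`IsSuitableWeakSolutionOn.stRescale` (the slab `(0, ∞) × ℝ³` is invariant, the rescaled zero force
is zero); `L²`/`L^{3/2}` integrability on `(0, T) × K` from that on `(0, βT) × Φ_x(K)`; (2) the
window of radius `R` for `w` (`(0, R²) × B(x₁, R)`) is the image of
`(0, βR²) × B(x₀ + γ x₁, γR) ⊆ (0, R'²) × B(x₀ + γx₁, R')`, `R' = max (γR) (√β R)`, so the bounds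
for `U` at radius `R'` give those for `w` at radius `R` (constants multiplied by `α² γ⁻³`, resp.
`(αγ)² (βγ³)⁻¹` for the gradient `(αγ) ∇U ∘ Φ`); (3) `∫_K |w(t) - w₀|² = α² γ⁻³ ∫_{Φ_x K} |U(βt) - U₀|² → 0`;
(7) `Φ_x = x₀ + γ ·` is a homeomorphism, hence proper, so decay at infinity is preserved. For
`α = γ = λ`, `β = λ²` this is the Navier–Stokes scaling (viscosity unchanged; Jia–Šverák 2013,
§1: "`u(x,t) → λu(λx, λ²t)`"); for `β = 1`, `α = √ν`, `γ = 1/√ν` it maps viscosity `1` to `ν`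
(Lemarié-Rieusset 2016, Ch. 14–15, general `ν`). [cite: CaffarelliKohnNirenberg1982, §2] -/
theorem IsLocalLeraySolution.stRescale {ν : ℝ} {U₀ : (EuclideanSpace ℝ (Fin 3)) → (EuclideanSpace ℝ (Fin 3))} {U : ℝ → (EuclideanSpace ℝ (Fin 3)) → (EuclideanSpace ℝ (Fin 3))} {P : ℝ → (EuclideanSpace ℝ (Fin 3)) → ℝ}
    (h : IsLocalLeraySolution ν U₀ U P) {α β γ : ℝ} (hα : 0 < α) (hγ : 0 < γ) (hβ : β = α * γ)
    (x₀ : (EuclideanSpace ℝ (Fin 3))) :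
    IsLocalLeraySolution (α * ν / γ) (fun y => α • U₀ (x₀ + γ • y)) (α • stPull β γ 0 x₀ U)
      (α ^ 2 • stPull β γ 0 x₀ P) := by
  have hβ0 : 0 < β := by rw [hβ]; positivity
  have hΦx_cont : Continuous (fun y : (EuclideanSpace ℝ (Fin 3)) => x₀ + γ • y) :=
    continuous_const.add (continuous_const_smul γ)
  -- (1)+(4): suitability on the invariant slab, zero force
  have hsuit : IsSuitableWeakSolutionOn (slab (EuclideanSpace ℝ (Fin 3)) (Ioi 0) isOpen_Ioi) (α * ν / γ) 0
      (α • stPull β γ 0 x₀ U) (α ^ 2 • stPull β γ 0 x₀ P) := by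
    have hs := h.suitable.stRescale hα hγ hβ 0 x₀
    have h0 : (α ^ 2 * γ) • stPull β γ 0 x₀ (0 : ℝ → (EuclideanSpace ℝ (Fin 3)) → (EuclideanSpace ℝ (Fin 3))) = 0 := by
      funext s y
      simp [stPull]
    rw [stPreimage_slab_Ioi_of_pos hβ0, h0] at hs
    exact hs
  refine
    { suitable := hsuit
      sqIntegrable := ?_
      pressure := ?_
      uniformLocalEnergy := ?_
      uniformLocalGradient := ?_
      initial := ?_
      decay := ?_ }
  · -- `w ∈ L²((0, T) × K)`
    intro T hT K hK
    rw [← stAffine_preimage_Ioo_prod_image hβ0 hγ.ne' x₀ T K,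
      setLIntegral_enorm_pow_stRescale hβ0 hγ 0 x₀ α U _ 2]
    exact ENNReal.mul_lt_top
      (ENNReal.mul_lt_top (ENNReal.pow_ne_top enorm_ne_top).lt_top ENNReal.ofReal_lt_top)
      (h.sqIntegrable (β * T) (by positivity) _ (hK.image hΦx_cont))
  · -- `q ∈ L^{3/2}((0, T) × K)`
    intro T hT K hK
    rw [← stAffine_preimage_Ioo_prod_image hβ0 hγ.ne' x₀ T K,
      setLIntegral_enorm_rpow_stRescale hβ0 hγ 0 x₀ (α ^ 2) P _ (by norm_num : (0 : ℝ) ≤ 3 / 2)]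
    exact ENNReal.mul_lt_top
      (ENNReal.mul_lt_top (ENNReal.rpow_lt_top_of_nonneg (by norm_num) enorm_ne_top)
        ENNReal.ofReal_lt_top)
      (h.pressure (β * T) (by positivity) _ (hK.image hΦx_cont))
  · -- (2), first half: uniformly local energy at radius `R` from radius `R'`
    intro R hR
    set R' := max (γ * R) (Real.sqrt β * R) with hR'
    have hR'pos : 0 < R' := rescale_radius_pos hγ hR
    obtain ⟨hγR, hβR⟩ := rescale_radius_le (γ := γ) hβ0.le hR.le
    obtain ⟨C, hC⟩ := h.uniformLocalEnergy R' hR'pos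
    set C₁ : ℝ≥0∞ := ‖α‖ₑ ^ 2 * (ENNReal.ofReal (γ ^ finrank ℝ (EuclideanSpace ℝ (Fin 3)))⁻¹ * C) with hC₁
    have hC₁top : C₁ ≠ ∞ := ENNReal.mul_ne_top (ENNReal.pow_ne_top enorm_ne_top)
      (ENNReal.mul_ne_top ENNReal.ofReal_ne_top ENNReal.coe_ne_top)
    refine ⟨C₁.toNNReal, ?_⟩
    rw [ENNReal.coe_toNNReal hC₁top]
    have hC' : ∀ᵐ t ∂(volume.restrict (Ioo (0 + β * 0) (0 + β * R ^ 2))), ∀ x₁ : (EuclideanSpace ℝ (Fin 3)),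
        ∫⁻ x in ball x₁ R', ‖U t x‖ₑ ^ 2 ≤ C := by
      rw [mul_zero, add_zero, zero_add]
      exact ae_restrict_of_ae_restrict_of_subset (Ioo_subset_Ioo le_rfl hβR) hC
    filter_upwards [ae_restrict_Ioo_comp_time_affine hβ0 0 0 (R ^ 2) hC'] with s hs x₁
    have key : ∫⁻ y in ball x₁ R, ‖(α • stPull β γ 0 x₀ U) s y‖ₑ ^ 2 =
        ‖α‖ₑ ^ 2 * (ENNReal.ofReal (γ ^ finrank ℝ (EuclideanSpace ℝ (Fin 3)))⁻¹ *
          ∫⁻ x in ball (x₀ + γ • x₁) (γ * R), ‖U (0 + β * s) x‖ₑ ^ 2) := by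
      have e1 : ∀ y, ‖(α • stPull β γ 0 x₀ U) s y‖ₑ ^ 2 =
          ‖α‖ₑ ^ 2 * ‖U (0 + β * s) (x₀ + γ • y)‖ₑ ^ 2 := by
        intro y
        rw [smul_stPull_apply, enorm_smul, mul_pow]
      simp_rw [e1]
      rw [lintegral_const_mul' _ _ (ENNReal.pow_ne_top enorm_ne_top),
        ← space_affine_preimage_ball_self hγ x₀ x₁ R,
        setLIntegral_preimage_comp_space_affine hγ x₀ (fun x => ‖U (0 + β * s) x‖ₑ ^ 2)]
    rw [key, hC₁]
    gcongr
    calc ∫⁻ x in ball (x₀ + γ • x₁) (γ * R), ‖U (0 + β * s) x‖ₑ ^ 2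
        ≤ ∫⁻ x in ball (x₀ + γ • x₁) R', ‖U (0 + β * s) x‖ₑ ^ 2 :=
          lintegral_mono_set (ball_subset_ball hγR)
      _ ≤ C := hs (x₀ + γ • x₁)
  · -- (2), second half: the weak gradient `(αγ) ∇U ∘ Φ` and its uniformly local bound
    obtain ⟨G, hG, hGb⟩ := h.uniformLocalGradient
    refine ⟨(α * γ) • stPull β γ 0 x₀ G, ?_, fun R hR => ?_⟩
    · have h1 := hG.stRescale α hβ0 hγ 0 x₀
      rw [stPreimage_slab_Ioi_of_pos hβ0] at h1
      exact h1
    · set R' := max (γ * R) (Real.sqrt β * R) with hR'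
      have hR'pos : 0 < R' := rescale_radius_pos hγ hR
      obtain ⟨hγR, hβR⟩ := rescale_radius_le (γ := γ) hβ0.le hR.le
      obtain ⟨C, hC⟩ := hGb R' hR'pos
      set C₁ : ℝ≥0∞ := ENNReal.ofReal ((α * γ) ^ 2) * ENNReal.ofReal (β * γ ^ finrank ℝ (EuclideanSpace ℝ (Fin 3)))⁻¹ * C
        with hC₁
      have hC₁top : C₁ ≠ ∞ :=
        ENNReal.mul_ne_top (ENNReal.mul_ne_top ENNReal.ofReal_ne_top ENNReal.ofReal_ne_top)
          ENNReal.coe_ne_top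
      refine ⟨C₁.toNNReal, fun x₁ => ?_⟩
      rw [ENNReal.coe_toNNReal hC₁top, ← stAffine_preimage_Ioo_prod_ball hβ0 hγ x₀ (R ^ 2) R x₁,
        setLIntegral_frobeniusNormSq_stRescale hβ0 hγ 0 x₀ (α * γ) G, hC₁]
      gcongr
      calc ∫⁻ z in Ioo 0 (β * R ^ 2) ×ˢ ball (x₀ + γ • x₁) (γ * R),
            ENNReal.ofReal (frobeniusNormSq (G z.1 z.2))
          ≤ ∫⁻ z in Ioo 0 (R' ^ 2) ×ˢ ball (x₀ + γ • x₁) R',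
              ENNReal.ofReal (frobeniusNormSq (G z.1 z.2)) :=
            lintegral_mono_set (prod_mono (Ioo_subset_Ioo le_rfl hβR) (ball_subset_ball hγR))
        _ ≤ C := hC (x₀ + γ • x₁)
  · -- (3): the datum is attained in `L²_loc`
    intro K hK
    have hlim := h.initial ((fun y : (EuclideanSpace ℝ (Fin 3)) => x₀ + γ • y) '' K) (hK.image hΦx_cont)
    have hmap : Tendsto (fun t : ℝ => β * t) (𝓝[>] 0) (𝓝[>] 0) := by
      refine tendsto_nhdsWithin_of_tendsto_nhds_of_eventually_within _ ?_ ?_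
      · have h1 : Tendsto (fun t : ℝ => β * t) (𝓝 0) (𝓝 (β * 0)) :=
          (continuous_const_mul β).tendsto 0
        rw [mul_zero] at h1
        exact h1.mono_left nhdsWithin_le_nhds
      · filter_upwards [self_mem_nhdsWithin] with t ht
        exact mul_pos hβ0 ht
    have h2 := hlim.comp hmap
    have key : (fun t => ∫⁻ y in K, ‖(α • stPull β γ 0 x₀ U) t y - α • U₀ (x₀ + γ • y)‖ₑ ^ 2) =
        fun t => ‖α‖ₑ ^ 2 * (ENNReal.ofReal (γ ^ finrank ℝ (EuclideanSpace ℝ (Fin 3)))⁻¹ *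
          ∫⁻ x in (fun y : (EuclideanSpace ℝ (Fin 3)) => x₀ + γ • y) '' K, ‖U (β * t) x - U₀ x‖ₑ ^ 2) := by
      funext t
      have e1 : ∀ y, ‖(α • stPull β γ 0 x₀ U) t y - α • U₀ (x₀ + γ • y)‖ₑ ^ 2 =
          ‖α‖ₑ ^ 2 * ‖U (β * t) (x₀ + γ • y) - U₀ (x₀ + γ • y)‖ₑ ^ 2 := by
        intro y
        rw [smul_stPull_apply, zero_add, ← smul_sub, enorm_smul, mul_pow]
      simp_rw [e1]
      rw [lintegral_const_mul' _ _ (ENNReal.pow_ne_top enorm_ne_top),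
        setLIntegral_comp_space_affine_image hγ x₀ (fun x => ‖U (β * t) x - U₀ x‖ₑ ^ 2) K]
    rw [key]
    have h3 := ENNReal.Tendsto.const_mul h2 (Or.inr ENNReal.ofReal_ne_top)
      (a := ENNReal.ofReal (γ ^ finrank ℝ (EuclideanSpace ℝ (Fin 3)))⁻¹)
    rw [mul_zero] at h3
    have h4 := ENNReal.Tendsto.const_mul h3 (Or.inr (ENNReal.pow_ne_top enorm_ne_top))
      (a := ‖α‖ₑ ^ 2)
    rw [mul_zero] at h4
    exact h4
  · -- (7): decay at spatial infinity (`Φ_x` is proper)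
    intro R hR
    set R' := max (γ * R) (Real.sqrt β * R) with hR'
    have hR'pos : 0 < R' := rescale_radius_pos hγ hR
    obtain ⟨hγR, hβR⟩ := rescale_radius_le (γ := γ) hβ0.le hR.le
    have htend : Tendsto (fun y : (EuclideanSpace ℝ (Fin 3)) => x₀ + γ • y) (cocompact (EuclideanSpace ℝ (Fin 3))) (cocompact (EuclideanSpace ℝ (Fin 3))) := by
      have h1 := (spaceAffineHomeomorph hγ.ne' x₀).map_cocompact
      rw [coe_spaceAffineHomeomorph] at h1
      exact h1.le
    have hdec := (h.decay R' hR'pos).comp htend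
    set c : ℝ≥0∞ := ‖α‖ₑ ^ 2 * ENNReal.ofReal (β * γ ^ finrank ℝ (EuclideanSpace ℝ (Fin 3)))⁻¹ with hc
    have hctop : c ≠ ∞ := ENNReal.mul_ne_top (ENNReal.pow_ne_top enorm_ne_top) ENNReal.ofReal_ne_top
    have hbig : Tendsto (fun x₁ : (EuclideanSpace ℝ (Fin 3)) => c * ∫⁻ z in Ioo 0 (R' ^ 2) ×ˢ ball (x₀ + γ • x₁) R',
        ‖U z.1 z.2‖ₑ ^ 2) (cocompact (EuclideanSpace ℝ (Fin 3))) (𝓝 0) := by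
      have h1 := ENNReal.Tendsto.const_mul hdec (Or.inr hctop) (a := c)
      rw [mul_zero] at h1
      exact h1
    refine tendsto_of_tendsto_of_tendsto_of_le_of_le tendsto_const_nhds hbig (fun _ => zero_le)
      fun x₁ => ?_
    show ∫⁻ z in Ioo 0 (R ^ 2) ×ˢ ball x₁ R, ‖(α • stPull β γ 0 x₀ U) z.1 z.2‖ₑ ^ 2 ≤
      c * ∫⁻ z in Ioo 0 (R' ^ 2) ×ˢ ball (x₀ + γ • x₁) R', ‖U z.1 z.2‖ₑ ^ 2
    rw [← stAffine_preimage_Ioo_prod_ball hβ0 hγ x₀ (R ^ 2) R x₁,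
      setLIntegral_enorm_pow_stRescale hβ0 hγ 0 x₀ α U _ 2]
    -- `gcongr` descends to `(0, βR²) × B(x₀ + γx₁, γR) ⊆ (0, R'²) × B(x₀ + γx₁, R')`, closed by
    -- `hβR`, `hγR`
    gcongr

end LocalLeray

/-! ### Parabolic rescaling of Kato solutions about the origin -/

section Kato

variable {T ν : ℝ} {u₀ : (EuclideanSpace ℝ (Fin 3)) → (EuclideanSpace ℝ (Fin 3))} {u : ℝ → (EuclideanSpace ℝ (Fin 3)) → (EuclideanSpace ℝ (Fin 3))}

/-- **Parabolic rescaling of Kato solutions on `[0, T)` about the origin**: `λ u(λ² ·, λ ·)`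
(`λ > 0`) is a Kato solution on `[0, T/λ²)` with the same viscosity and datum `λ u₀(λ ·)`
(`rescaleData λ u₀`); the accepted `kato_local_rescale_translate` with `x₀ = 0`
(Rusin–Šverák 2011, §1 p. 3: the scaling `u₀(x) ↦ λ u₀(λ x)`; the viscosity scaling
`IsKatoSolutionOn.timeRescale` is in `LerayFarFieldRegularity.lean`). [cite: RusinSverak2011, §1 (arXiv:0911.0500 p. 3)] -/
theorem IsKatoSolutionOn.nsRescale (h : IsKatoSolutionOn T ν u₀ u) {c : ℝ} (hc : 0 < c) :
    IsKatoSolutionOn (T / c ^ 2) ν (rescaleData c u₀) (fun t x => c • u (c ^ 2 * t) (c • x)) := by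
  obtain ⟨h1, h2, h3, h4⟩ := kato_local_rescale_translate h.mild h.continuousInLpOn h.initial
    h.aestronglyMeasurable hc 0
  simp only [sub_zero] at h1 h2 h3 h4
  exact ⟨h1, h2, h3, h4⟩

end Kato

end Literature.Analysis.FluidPDE

end
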